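import Literature.NumberTheory.EllipticCurves.TwoDescentHalvingGalois
import Literature.NumberTheory.EllipticCurves.TwoDescentRankBounds
import HarnessLib
import HarnessLib.Audit.Tags

/-!
# The explicit halving point under a `K`-automorphism of an extension field `L ⊇ K`:
# the `2`-descent / Kummer dictionary in `σ`-currency (cell `bsd-f2-manin`, seat `-es` g39, MEMO-es §60.8 «D4σ»)

Sequel of `TwoDescentHalvingGalois.lean` (the explicit halving formulas over any field) and the
`σ`-currency twin of `TwoDescentHalvingGeometric.lean` (which works in `E(K̄)` with the profinite
`Γ_K` acting on `geomPoints`).  Here the field of the halves is ANY field `L` with `Algebra K L`, the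
group is `L ≃ₐ[K] L`, and the action on `E(L) = (W.baseChange L).toAffine.Point` is Mathlib's
`WeierstrassCurve.Affine.Point.map (τ : L →ₐ[K] L)` — the currency of the Kummer–diamond line of the cell
(`K = ℚ`, `L = ℂ`, `τ = σ : ℂ ≃ₐ[ℚ] ℂ`; MEMO-es §59–§60, THEOREM K `indexFour_kummerDiamondReciprocity`, and
PROPOSITION A `StepTwo.propositionA_complex`, whose Kummer classes are the functions `σ ↦ σS − S`).

For `h : W.toAffine.SplitTwoTorsion e₁ e₂ e₃` (rational `2`-torsion over `K`), `x₀ ∈ K` and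
`u₁, u₂, u₃ ∈ L` with `ι x₀ − ι eᵢ = uᵢ²` (`ι = algebraMap K L`), write `Q(u) ∈ E(L)` for the explicit halving
point `some _ _ (nonsingular_halving (h.map L) hu₁ hu₂ hu₃)` and `Tᵢ = (ι eᵢ, ·) ∈ E(L)[2]`.  Proved here:

* `algEquiv_halving_sign_cases`: `τ` negates an even number of the `uᵢ` when `u₁u₂u₃ ∈ ι K`
  (port of `halving_sign_cases`);
* `map_halving`: `τ • Q(u) = Q(τu)`; `map_twoTorsion`: `τ • T₁ = T₁`;
* `map_halving_sub_self_cases` — THE TABLE: exactly the four rows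
  `(τu = u, τQ − Q = O)`, `((+,−,−), τQ − Q = T₁)`, `((−,+,−), T₂)`, `((−,−,+), T₃)`
  (Silverman AEC X.1, proof of Thm. X.1.1);
* `map_sub_self_eq_of_add_self_eq`: two halves of the same point have the same Kummer cocycle
  (`S + S = Q + Q → τS − S = τQ − Q`, since `E(L)[2] = {O, T₁, T₂, T₃}` is fixed by `τ`);
* `map_sub_self_reading₁/₂/₃` — THE DICTIONARY for an ARBITRARY half `S` of `ι(x₀, y₀)`: there is a sign
  `s = ±1` with `τ uᵢ = s uᵢ` AND `τ(uⱼu_k) = s uⱼu_k`, and `s = 1 ↔ τS − S ∈ {O, Tᵢ}`,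
  `s = −1 ↔ τS − S ∈ {Tⱼ, T_k}` — the square class read through `Tᵢ` is that of `x₀ − eᵢ`, or, when
  `x₀ = eᵢ` (`uᵢ = 0`, the point `Tᵢ` itself), that of `(eᵢ − eⱼ)(eᵢ − e_k) = (uⱼu_k)²` — the diagonal rule of
  the `2`-descent map (`twoDescentComponent`), built in;
* `exists_halving_data`: over an algebraically closed `L` the data `(u₁, u₂, u₃)` exist for every `K`-point;
* `map_sub_self_halfTwoTorsion_reading₁/₂/₃` (§5): the three readings for a half `S` of `T₁` ITSELF (`S + S = T₁`,
  `u₁ = 0`): the entries `δ₁(T₁) = (e₁ − e₂)(e₁ − e₃)`, `δ₂(T₁) = e₁ − e₂`, `δ₃(T₁) = e₁ − e₃` of the descent table.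

USE (LEAD p1 V1–V3 / p2 PROPOSITION A, `K = ℚ`, `L = ℂ`): for a rational `2`-torsion curve in `W₀`'s own
coordinates `e₁ < e₂ < e₃` (`A = e₂ − e₁`, `B = e₃ − e₁`), the halves `S₁, S₂` of `T₁, T₂` have Kummer classes
read by the dictionary through the representatives `δ₁(T₁) = (e₁−e₂)(e₁−e₃) = AB`, `δ₂(T₁) = e₁ − e₂ = −A`,
`δ₁(T₂) = A`, `δ₂(T₂) = (e₂−e₁)(e₂−e₃) = A(A−B)` — the pairs `ht₁, ht₂` of
`KummerDiamondStepTwo.descent_table_of_diamond_classes` (the `u = 1` change to the Legendre model preserves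
`x`-differences, so no point-level variable change is needed).

Theorem-only; no `instance` is declared: the statements carry the binder `[(W.baseChange L).IsElliptic]`
(discharge: `inferInstanceAs ((W.map (algebraMap K L)).IsElliptic)`).  No named fact is used.

## References
* [SilvermanAEC2009] J. H. Silverman, *The Arithmetic of Elliptic Curves*, 2nd ed., GTM 106, Springer 2009,
  Thm. X.1.1 (and its proof), Prop. X.1.4.
* [Knapp1993] A. W. Knapp, *Elliptic Curves*, Princeton 1993, Thm. 4.2.

TYPER NOTE (typer g21, T-es-80, part 1 of 2).  SOURCE = HOME/es/g39/TwoDescentHalvingAlgEquiv-es-g39-v2.lean sha16 ce944fbd0e140afe (559 l., 22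
theorems; es: farm rc 0·0·0·0 05:18Z, std axioms; MEMO-es §60.8 «D4σ»; evidence #49 on 22967) VERBATIM, SPLIT at the `### §3` boundary
(source l. 293) for the 400-line cap on theorem-bearing files, as es requested: THIS file = §§1–2 (sign cases, `map_halving`, `map_twoTorsion`,
the table `map_halving_sub_self_cases`, ANY-HALF `map_sub_self_eq_of_add_self_eq`, helpers); the sibling `TwoDescentHalvingAlgEquivReadings.lean`
(imports this file) = §§3–5 (the readings, `exists_halving_data`, the half-two-torsion corollaries, `exists_sq_eq_twoTorsion_differences`).
Deltas: the private bookkeeping lemma `sign_iff_of_imp` moved to part 2 (its only users are the readings); the four public declarations the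
source tagged `[folklore]` (`nonsingular_algebraMap`, `twoTorsionY_algebraMap`, `twoTorsion_eq_some_algebraMap`, `exists_sq_eq_twoTorsion_differences`,
all in part 2) carry `[cite: SilvermanAEC2009, §X.1 …]` locators instead (Literature lint: public `[folklore]` theorems are refused); this note.
No def, no instance, no new named fact (net debt 0); imports only Literature `TwoDescentHalvingGalois` + `TwoDescentRankBounds` as in the source.
Dedup check at landing (rg 05:2xZ): the tree's same-named `algEquiv_apply_eq_or_eq_neg_of_sq_eq` (3 files), `map_halving` (LEAD p1's ℚ/ℂ instance in
`Theorems/ManinLocalTwoThreeKummerDiamondHalvingCocycle.lean`), `map_twoTorsion` (Monsky1990), `nonsingular_algebraMap` (SqrtThree) live in other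
namespaces with different statements.
-/

noncomputable section

open scoped Classical

namespace WeierstrassCurve

open WeierstrassCurve.Affine WeierstrassCurve.Affine.Point

variable {K L : Type*} [Field K] [Field L] [CharZero L] [Algebra K L]
  {W : WeierstrassCurve K} {e₁ e₂ e₃ : K}

/-! ### §1 Square roots of elements of `K` under a `K`-automorphism of `L` -/

omit [CharZero L] in
/-- A `K`-automorphism of `L` sends a square root of an element of `K` to `±` itself.
[cite: SilvermanAEC2009, Thm. X.1.1] -/
theorem algEquiv_apply_eq_or_eq_neg_of_sq_eq (τ : L ≃ₐ[K] L) {u : L} {c : K}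
    (hu : algebraMap K L c = u ^ 2) : τ u = u ∨ τ u = -u := by
  rw [← sq_eq_sq_iff_eq_or_eq_neg, ← map_pow, ← hu, AlgEquiv.commutes]

/-- **The sign pattern of a conjugate of the halving data** (port of `halving_sign_cases` from `Γ_K` on
`K̄` to `L ≃ₐ[K] L`): if `uᵢ² = ι(x₀ − eᵢ)` and `u₁u₂u₃ = ι c` with `x₀, eᵢ, c ∈ K`, then `τ` negates an even
number of the `uᵢ` (a vanishing `uᵢ` has both signs and is assigned the one making the count even).
[cite: SilvermanAEC2009, Thm. X.1.1] -/
theorem algEquiv_halving_sign_cases (τ : L ≃ₐ[K] L) {x₀ c : K} {u₁ u₂ u₃ : L}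
    (hu₁ : algebraMap K L x₀ - algebraMap K L e₁ = u₁ ^ 2)
    (hu₂ : algebraMap K L x₀ - algebraMap K L e₂ = u₂ ^ 2)
    (hu₃ : algebraMap K L x₀ - algebraMap K L e₃ = u₃ ^ 2)
    (hy : algebraMap K L c = u₁ * u₂ * u₃) :
    (τ u₁ = u₁ ∧ τ u₂ = u₂ ∧ τ u₃ = u₃) ∨ (τ u₁ = u₁ ∧ τ u₂ = -u₂ ∧ τ u₃ = -u₃) ∨
      (τ u₁ = -u₁ ∧ τ u₂ = u₂ ∧ τ u₃ = -u₃) ∨ (τ u₁ = -u₁ ∧ τ u₂ = -u₂ ∧ τ u₃ = u₃) := by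
  have hfix : τ (u₁ * u₂ * u₃) = u₁ * u₂ * u₃ := by rw [← hy, AlgEquiv.commutes]
  have h1 := algEquiv_apply_eq_or_eq_neg_of_sq_eq τ (c := x₀ - e₁) (by rw [map_sub]; exact hu₁)
  have h2 := algEquiv_apply_eq_or_eq_neg_of_sq_eq τ (c := x₀ - e₂) (by rw [map_sub]; exact hu₂)
  have h3 := algEquiv_apply_eq_or_eq_neg_of_sq_eq τ (c := x₀ - e₃) (by rw [map_sub]; exact hu₃)
  have key : ∀ v : L, -v = v → v = 0 := by
    intro v hv
    have h2v : (2 : L) * v = 0 := by linear_combination -hv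
    exact (mul_eq_zero.mp h2v).resolve_left two_ne_zero
  have hzero : ∀ {v : L}, v = 0 → τ v = v ∧ τ v = -v := by
    intro v hv
    subst hv; simp
  rcases h1 with h1 | h1 <;> rcases h2 with h2 | h2 <;> rcases h3 with h3 | h3
  · exact Or.inl ⟨h1, h2, h3⟩
  · have h0 : u₁ * u₂ * u₃ = 0 := by
      rw [map_mul, map_mul, h1, h2, h3] at hfix
      exact key _ (by linear_combination hfix)
    rcases mul_eq_zero.mp h0 with h0 | h0
    · rcases mul_eq_zero.mp h0 with h0 | h0
      · exact Or.inr (Or.inr (Or.inl ⟨(hzero h0).2, h2, h3⟩))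
      · exact Or.inr (Or.inl ⟨h1, (hzero h0).2, h3⟩)
    · exact Or.inl ⟨h1, h2, (hzero h0).1⟩
  · have h0 : u₁ * u₂ * u₃ = 0 := by
      rw [map_mul, map_mul, h1, h2, h3] at hfix
      exact key _ (by linear_combination hfix)
    rcases mul_eq_zero.mp h0 with h0 | h0
    · rcases mul_eq_zero.mp h0 with h0 | h0
      · exact Or.inr (Or.inr (Or.inr ⟨(hzero h0).2, h2, h3⟩))
      · exact Or.inl ⟨h1, (hzero h0).1, h3⟩
    · exact Or.inr (Or.inl ⟨h1, h2, (hzero h0).2⟩)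
  · exact Or.inr (Or.inl ⟨h1, h2, h3⟩)
  · have h0 : u₁ * u₂ * u₃ = 0 := by
      rw [map_mul, map_mul, h1, h2, h3] at hfix
      exact key _ (by linear_combination hfix)
    rcases mul_eq_zero.mp h0 with h0 | h0
    · rcases mul_eq_zero.mp h0 with h0 | h0
      · exact Or.inl ⟨(hzero h0).1, h2, h3⟩
      · exact Or.inr (Or.inr (Or.inr ⟨h1, (hzero h0).2, h3⟩))
    · exact Or.inr (Or.inr (Or.inl ⟨h1, h2, (hzero h0).2⟩))
  · exact Or.inr (Or.inr (Or.inl ⟨h1, h2, h3⟩))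
  · exact Or.inr (Or.inr (Or.inr ⟨h1, h2, h3⟩))
  · have h0 : u₁ * u₂ * u₃ = 0 := by
      rw [map_mul, map_mul, h1, h2, h3] at hfix
      exact key _ (by linear_combination hfix)
    rcases mul_eq_zero.mp h0 with h0 | h0
    · rcases mul_eq_zero.mp h0 with h0 | h0
      · exact Or.inr (Or.inl ⟨(hzero h0).1, h2, h3⟩)
      · exact Or.inr (Or.inr (Or.inl ⟨h1, (hzero h0).1, h3⟩))
    · exact Or.inr (Or.inr (Or.inr ⟨h1, h2, (hzero h0).1⟩))

/-! ### §2 The halving point and the `2`-torsion points under `τ` -/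

section Halving

variable [(W.baseChange L).IsElliptic]

/-- **`τ • Q(u₁, u₂, u₃) = Q(τu₁, τu₂, τu₃)`** in `E(L)` for the explicit halving point (its coordinates are
polynomials in the `uᵢ` with coefficients in `ι K`). [cite: SilvermanAEC2009, Thm. X.1.1] -/
theorem map_halving (h : W.toAffine.SplitTwoTorsion e₁ e₂ e₃) (τ : L ≃ₐ[K] L) {x₀ : K}
    {u₁ u₂ u₃ v₁ v₂ v₃ : L}
    (hu₁ : algebraMap K L x₀ - algebraMap K L e₁ = u₁ ^ 2)
    (hu₂ : algebraMap K L x₀ - algebraMap K L e₂ = u₂ ^ 2)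
    (hu₃ : algebraMap K L x₀ - algebraMap K L e₃ = u₃ ^ 2)
    (hv₁ : algebraMap K L x₀ - algebraMap K L e₁ = v₁ ^ 2)
    (hv₂ : algebraMap K L x₀ - algebraMap K L e₂ = v₂ ^ 2)
    (hv₃ : algebraMap K L x₀ - algebraMap K L e₃ = v₃ ^ 2)
    (h₁ : τ u₁ = v₁) (h₂ : τ u₂ = v₂) (h₃ : τ u₃ = v₃) :
    Affine.Point.map (W' := W) (τ : L →ₐ[K] L)
        (Affine.Point.some _ _ (Affine.Point.nonsingular_halving (h.map L) hu₁ hu₂ hu₃)) =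
      Affine.Point.some _ _ (Affine.Point.nonsingular_halving (h.map L) hv₁ hv₂ hv₃) := by
  rw [Affine.Point.map_some]
  simp only [Affine.Point.some.injEq, AlgEquiv.coe_toAlgHom]
  constructor
  · simp only [map_add, map_mul, τ.commutes, h₁, h₂, h₃]
  · simp only [map_sub, map_div₀, map_add, map_mul, map_ofNat, τ.commutes, h₁, h₂, h₃,
      baseChange, map_a₁, map_a₃]

/-- **`τ • T₁ = T₁`**: the `K`-rational `2`-torsion point `T₁ = (ι e₁, −(a₁ ι e₁ + a₃)/2)` of `E(L)` is fixed
by every `K`-automorphism of `L` (apply to `h.swap₁₂`, `h.swap₂₃.swap₁₂` for `T₂`, `T₃`).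
[cite: SilvermanAEC2009, Prop. X.1.4] -/
theorem map_twoTorsion (h : W.toAffine.SplitTwoTorsion e₁ e₂ e₃) (τ : L ≃ₐ[K] L) :
    Affine.Point.map (W' := W) (τ : L →ₐ[K] L)
        (Affine.Point.some _ _ (Affine.nonsingular_twoTorsion (h.map L))) =
      Affine.Point.some _ _ (Affine.nonsingular_twoTorsion (h.map L)) := by
  rw [Affine.Point.map_some]
  simp only [Affine.Point.some.injEq, AlgEquiv.coe_toAlgHom]
  constructor
  · exact τ.commutes _
  · simp only [Affine.twoTorsionY, map_neg, map_div₀, map_add, map_mul, map_ofNat, τ.commutes,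
      baseChange, map_a₁, map_a₃]

omit [CharZero L] [(W.baseChange L).IsElliptic] in
/-- `T₁ ≠ O` in `E(L)`. [cite: SilvermanAEC2009, Prop. X.1.4] -/
theorem twoTorsion_baseChange_ne_zero {e : L} {y : L} (he : (W.baseChange L).toAffine.Nonsingular e y) :
    (Affine.Point.some _ _ he : (W.baseChange L).toAffine.Point) ≠ 0 := by
  intro h0
  cases h0

/-- **The Kummer cocycle of the explicit half — THE TABLE.**  For `Q = Q(u₁, u₂, u₃)` with `u₁u₂u₃ ∈ ι K`
exactly one of: `τ` fixes all `uᵢ` and `τQ − Q = O`; `τ` negates `u₂, u₃` and `τQ − Q = T₁`; negates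
`u₁, u₃` and `τQ − Q = T₂`; negates `u₁, u₂` and `τQ − Q = T₃` (`Q + T₁ = Q(u₁, −u₂, −u₃)` etc.,
`halving_add_twoTorsionᵢ`).  Silverman AEC X.1, proof of Thm. X.1.1. [cite: SilvermanAEC2009, Thm. X.1.1] -/
theorem map_halving_sub_self_cases (h : W.toAffine.SplitTwoTorsion e₁ e₂ e₃) (τ : L ≃ₐ[K] L)
    {x₀ c : K} {u₁ u₂ u₃ : L}
    (hu₁ : algebraMap K L x₀ - algebraMap K L e₁ = u₁ ^ 2)
    (hu₂ : algebraMap K L x₀ - algebraMap K L e₂ = u₂ ^ 2)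
    (hu₃ : algebraMap K L x₀ - algebraMap K L e₃ = u₃ ^ 2)
    (hy : algebraMap K L c = u₁ * u₂ * u₃)
    {Q : (W.baseChange L).toAffine.Point}
    (hQ : Q = Affine.Point.some _ _ (Affine.Point.nonsingular_halving (h.map L) hu₁ hu₂ hu₃)) :
    (τ u₁ = u₁ ∧ τ u₂ = u₂ ∧ τ u₃ = u₃ ∧
        Affine.Point.map (W' := W) (τ : L →ₐ[K] L) Q - Q = 0) ∨
      (τ u₁ = u₁ ∧ τ u₂ = -u₂ ∧ τ u₃ = -u₃ ∧
        Affine.Point.map (W' := W) (τ : L →ₐ[K] L) Q - Q =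
          Affine.Point.some _ _ (Affine.nonsingular_twoTorsion (h.map L))) ∨
      (τ u₁ = -u₁ ∧ τ u₂ = u₂ ∧ τ u₃ = -u₃ ∧
        Affine.Point.map (W' := W) (τ : L →ₐ[K] L) Q - Q =
          Affine.Point.some _ _ (Affine.nonsingular_twoTorsion (h.map L).swap₁₂)) ∨
      (τ u₁ = -u₁ ∧ τ u₂ = -u₂ ∧ τ u₃ = u₃ ∧
        Affine.Point.map (W' := W) (τ : L →ₐ[K] L) Q - Q =
          Affine.Point.some _ _ (Affine.nonsingular_twoTorsion (h.map L).swap₂₃.swap₁₂)) := by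
  subst hQ
  rcases algEquiv_halving_sign_cases (e₁ := e₁) (e₂ := e₂) (e₃ := e₃) τ hu₁ hu₂ hu₃ hy with
    ⟨h1, h2, h3⟩ | ⟨h1, h2, h3⟩ | ⟨h1, h2, h3⟩ | ⟨h1, h2, h3⟩
  · refine Or.inl ⟨h1, h2, h3, ?_⟩
    rw [sub_eq_zero]
    exact map_halving h τ hu₁ hu₂ hu₃ hu₁ hu₂ hu₃ h1 h2 h3
  · refine Or.inr (Or.inl ⟨h1, h2, h3, ?_⟩)
    apply sub_eq_of_eq_add'
    rw [Affine.Point.halving_add_twoTorsion₁ (h.map L) hu₁ hu₂ hu₃]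
    exact map_halving h τ hu₁ hu₂ hu₃ hu₁ (by rw [hu₂]; ring) (by rw [hu₃]; ring) h1 h2 h3
  · refine Or.inr (Or.inr (Or.inl ⟨h1, h2, h3, ?_⟩))
    apply sub_eq_of_eq_add'
    rw [Affine.Point.halving_add_twoTorsion₂ (h.map L) hu₁ hu₂ hu₃]
    exact map_halving h τ hu₁ hu₂ hu₃ (by rw [hu₁]; ring) hu₂ (by rw [hu₃]; ring) h1 h2 h3
  · refine Or.inr (Or.inr (Or.inr ⟨h1, h2, h3, ?_⟩))
    apply sub_eq_of_eq_add'
    rw [Affine.Point.halving_add_twoTorsion₃ (h.map L) hu₁ hu₂ hu₃]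
    exact map_halving h τ hu₁ hu₂ hu₃ (by rw [hu₁]; ring) (by rw [hu₂]; ring) hu₃ h1 h2 h3

/-- **Two halves of the same point have the same Kummer cocycle**: if `S + S = Q + Q` in `E(L)` then
`τS − S = τQ − Q` — `S − Q ∈ E(L)[2] = {O, T₁, T₂, T₃}` (`eq_zero_or_eq_twoTorsion_of_two_nsmul_eq_zero`,
rational `2`-torsion) is fixed by `τ`.  Silverman AEC X.1 (the Kummer pairing is well defined on
`E(K)/2E(K)`, independent of the chosen half). [cite: SilvermanAEC2009, Thm. X.1.1, Prop. X.1.4] -/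
theorem map_sub_self_eq_of_add_self_eq (h : W.toAffine.SplitTwoTorsion e₁ e₂ e₃) (τ : L ≃ₐ[K] L)
    {S Q : (W.baseChange L).toAffine.Point} (hSQ : S + S = Q + Q) :
    Affine.Point.map (W' := W) (τ : L →ₐ[K] L) S - S =
      Affine.Point.map (W' := W) (τ : L →ₐ[K] L) Q - Q := by
  have h2 : (2 : ℕ) • (S - Q) = 0 := by
    rw [two_nsmul, sub_add_sub_comm, hSQ, sub_self]
  have hfix : Affine.Point.map (W' := W) (τ : L →ₐ[K] L) (S - Q) = S - Q := by
    rcases Affine.Point.eq_zero_or_eq_twoTorsion_of_two_nsmul_eq_zero (h.map L) h2 with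
      h0 | h0 | h0 | h0
    · rw [h0, _root_.map_zero]
    · rw [h0]; exact map_twoTorsion h τ
    · rw [h0]; exact map_twoTorsion h.swap₁₂ τ
    · rw [h0]; exact map_twoTorsion h.swap₂₃.swap₁₂ τ
  rw [map_sub] at hfix
  exact sub_eq_sub_iff_sub_eq_sub.mp hfix

/-- **`2 • Q(u) = ι P`** for `P = (x₀, y₀) ∈ E(K)` when the signs are normalised by
`u₁u₂u₃ = ι(y₀ + (a₁x₀ + a₃)/2)` (`halving_add_self` over `L`, hypotheses in `K`-form). [cite: Knapp1993, Thm. 4.2] -/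
theorem halving_add_self_algebraMap (h : W.toAffine.SplitTwoTorsion e₁ e₂ e₃) {x₀ y₀ : K}
    {u₁ u₂ u₃ : L}
    (hu₁ : algebraMap K L x₀ - algebraMap K L e₁ = u₁ ^ 2)
    (hu₂ : algebraMap K L x₀ - algebraMap K L e₂ = u₂ ^ 2)
    (hu₃ : algebraMap K L x₀ - algebraMap K L e₃ = u₃ ^ 2)
    (hy₀ : algebraMap K L (y₀ + (W.a₁ * x₀ + W.a₃) / 2) = u₁ * u₂ * u₃)
    {h₀ : (W.baseChange L).toAffine.Nonsingular (algebraMap K L x₀) (algebraMap K L y₀)} :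
    Affine.Point.some _ _ (Affine.Point.nonsingular_halving (h.map L) hu₁ hu₂ hu₃) +
        Affine.Point.some _ _ (Affine.Point.nonsingular_halving (h.map L) hu₁ hu₂ hu₃) =
      Affine.Point.some _ _ h₀ := by
  have hy₀' : algebraMap K L y₀ +
      ((W.baseChange L).a₁ * algebraMap K L x₀ + (W.baseChange L).a₃) / 2 = u₁ * u₂ * u₃ := by
    rw [← hy₀]
    simp only [map_add, map_div₀, map_mul, map_ofNat, baseChange, map_a₁, map_a₃]
  exact Affine.Point.halving_add_self (h.map L) h₀ hu₁ hu₂ hu₃ hy₀'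

omit [CharZero L] [(W.baseChange L).IsElliptic] in
/-- `(u₂u₃)² = ι((x₀ − e₂)(x₀ − e₃))`; at `x₀ = e₁` this is the diagonal-rule representative `(e₁ − e₂)(e₁ − e₃)`
of the first `2`-descent component of `T₁` (`twoDescentComponent`). [cite: SilvermanAEC2009, Prop. X.1.4] -/
theorem mul_sq_eq_algebraMap {x₀ : K} {u₂ u₃ : L}
    (hu₂ : algebraMap K L x₀ - algebraMap K L e₂ = u₂ ^ 2)
    (hu₃ : algebraMap K L x₀ - algebraMap K L e₃ = u₃ ^ 2) :
    algebraMap K L ((x₀ - e₂) * (x₀ - e₃)) = (u₂ * u₃) ^ 2 := by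
  rw [map_mul, map_sub, map_sub, hu₂, hu₃]; ring

/-- `{O, T₁} ∩ {T₂, T₃} = ∅` in `E(L)` (the four `2`-torsion points are distinct). [cite: SilvermanAEC2009, Prop. X.1.4] -/
theorem not_mem_zero_twoTorsion_and (h : W.toAffine.SplitTwoTorsion e₁ e₂ e₃)
    {D : (W.baseChange L).toAffine.Point} :
    ¬ ((D = 0 ∨ D = Affine.Point.some _ _ (Affine.nonsingular_twoTorsion (h.map L))) ∧
        (D = Affine.Point.some _ _ (Affine.nonsingular_twoTorsion (h.map L).swap₁₂) ∨
          D = Affine.Point.some _ _ (Affine.nonsingular_twoTorsion (h.map L).swap₂₃.swap₁₂))) := by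
  rintro ⟨hP | hP, hR | hR⟩ <;> rw [hP] at hR
  · exact twoTorsion_baseChange_ne_zero _ hR.symm
  · exact twoTorsion_baseChange_ne_zero _ hR.symm
  · exact (h.map L).ne₁₂ (Affine.Point.some.inj hR).1
  · exact (h.map L).ne₁₃ (Affine.Point.some.inj hR).1

end Halving

end WeierstrassCurve

end
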